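import Literature.AlgebraicGeometry.GroupSchemes.IsotropicSubgroupEqOfBlockEq     -- ★ (BLK) `exists_comp_eq_iff_of_lagrangian_of_blocks`, the `cartierDual` block-duality currency
import HarnessLib

/-!
# Two homomorphisms out of a group scheme have THE SAME KERNEL once their kernels, read inside one self-dual layer, are Lagrangian, block-stable and agree on one block
# ([Mumford AV] §23 Thm. 2 (p. 231); [Tate 1997] §(3.7)–(3.8); [MFK 1994] Ch. 7 §2 Def. 7.2)

Topic `Literature/AlgebraicGeometry/GroupSchemes`; namespace `Literature.AlgebraicGeometry.GroupSchemes.AffineGroupScheme` (continues ★ `IsotropicSubgroupEqOfBlockEq`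
= (BLK) in the SAME abstract-duality currency `e : G ≅ G^D`, `κ^D = cartierDualMap κ`).  THEOREMS ONLY (no definition, no named fact, no instance, no notation,
no `sorry`).  Cell `hodgecm-mathlib`, P6 «MOD programme» (crux hLiu418 = stmt-HodgeConjecture-24832, `--supports`, count-neutral).  These five lemmas are the
GENERIC GLUE between (BLK) and its consumers — the kernel-comparison step «`Ker ψ₁ = Ker ψ₂` on all `T`-points» of [Liu 2021, Prop. D.8 (2)] at the special
fibre ((C6′), served leaflet `Cruxes/HLiu418/Lines/F0_P6a_SpecOrgans.lean` §I) and at the generic fibre ((C6′-Ω)); until now they travelled BY COPY between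
three leaflets∕organ files, this file is their single home.

THE MATHEMATICS.  `X` a group scheme over a field `k`, `ψᵢ : X → Yᵢ` (`i = 1, 2`) homomorphisms, `j : G → X` a «layer» whose `T`-points are exactly the points
killed by a set `𝔞` of endomorphisms `act a` of `X` (`hj`), and both kernels killed by `𝔞` (`hKᵢ`) — so `Ker ψᵢ ⊂ G` on points.  Inside `G` (finite commutative,
self-dual via `e : G ≅ G^D`, with an adjoint pair of idempotents `ε_W ε_V = 1`, `ε_W ≫ e = e ≫ ε_V^D`) the kernels are realised by monomorphisms `κᵢ : Kᵢ ↪ G`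
(`hκᵢ`).  (BLK) says: `Kᵢ` Lagrangian (`hlagᵢ`), `ε_V`-stable (`hVᵢ`) and with the same `ε_V`-fixed part (`hV`) ⇒ `K₁ = K₂` on `G`-points; pulling back along
`hj` gives `Ker ψ₁ = Ker ψ₂` on ALL `T`-points of `X` (**`comp_eq_one_iff_of_blocks`**).  The two side conditions are supplied by: **`exists_comp_eq_comp_of_equivariant`**
— if `ε_V ≫ j = j ≫ act c` and `ψ` intertwines `act c` with a HOMOMORPHISM `act' c` of the target, `Ker (j ≫ ψ)` is `ε_V`-stable ([MFK] Def. 7.2: equivariance);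
**`one_comp_eq_one_of_comm`** ∕ **`exists_comp_eq_comp_of_comm`** — the same when the target intertwiner `b` is only known to satisfy `act c ≫ ψ = ψ ≫ b` with
`act c`, `ψ` homomorphisms (then `η ≫ b = η` automatically, which is all the stability argument uses); **`exists_comp_iff_of_dock`** — if the `ε_V`-fixed points
of `G` factor through a «dock» `ι₀ : G₀ → X` on which both kernels are read by ONE clause `Pd`, the `V`-parts agree ([Tate 1997] (3.7): a closed subgroup is
determined by its functor of points).

## References
* [MumfordAV1970] D. Mumford, *Abelian Varieties* (1970), §23 Thm. 2 (p. 231).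
* [Tate1997FiniteFlatGroupSchemes] J. Tate, *Finite flat group schemes*, in: Modular Forms and Fermat's Last Theorem (1997), §(3.7)–(3.8), pp. 143–146.
* [MumfordFogartyKirwan1994] D. Mumford, J. Fogarty, F. Kirwan, *Geometric Invariant Theory*, 3rd ed. (1994), Ch. 7 §2 Definition 7.2 (p. 129).
-/

set_option autoImplicit false

-- Mathlib's `Over`/`Scheme` APIs are stated across semireducible wrappers (as in the ★ `GroupSchemes/*` files).
set_option backward.isDefEq.respectTransparency false

universe u

open CategoryTheory CategoryTheory.Limits AlgebraicGeometry MonoidalCategory CartesianMonoidalCategory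

noncomputable section

namespace Literature.AlgebraicGeometry.GroupSchemes

namespace AffineGroupScheme

open scoped MonObj

open Literature.AlgebraicGeometry.Motives GroupSchemeKernel

/-! ### §1 Kernel equality from (BLK), and `ε_V`-stability ∕ equal `V`-parts from equivariance ∕ a dock -/

section KernelEqOfBlocks



variable {k : Type u} [Field k]
  {X Y₁ Y₂ : SchemeOver k} [GrpObj X] [GrpObj Y₁] [GrpObj Y₂]
  (G : SchemeOver k) [GrpObj G] [IsCommMonObj G] [IsAffine G.left]
  (j : G ⟶ X) (e : G ≅ cartierDual G) (εW εV : G ⟶ G) [IsMonHom εV]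
  (K₁ : SchemeOver k) [GrpObj K₁] [IsCommMonObj K₁] [IsAffine K₁.left] [Module.Free k (Alg K₁)] [Module.Finite k (Alg K₁)]
  (κ₁ : K₁ ⟶ G) [IsMonHom κ₁] [Mono κ₁]
  (K₂ : SchemeOver k) [GrpObj K₂] [IsCommMonObj K₂] [IsAffine K₂.left] [Module.Free k (Alg K₂)] [Module.Finite k (Alg K₂)]
  (κ₂ : K₂ ⟶ G) [IsMonHom κ₂] [Mono κ₂]
  (ψ₁ : X ⟶ Y₁) (ψ₂ : X ⟶ Y₂)

/-- **(C6′-core) `comp_eq_one_iff_of_blocks`** — two homomorphisms whose kernels are Lagrangian, `ε_V`-stable, with the same `V`-part inside one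
self-dual layer have the same kernel on all `T`-points (★ (BLK) `exists_comp_eq_iff_of_lagrangian_of_blocks` applied once).
[cite: MumfordAV1970, §23 Thm. 2 (p. 231)] [cite: Tate1997FiniteFlatGroupSchemes, §(3.8) pp. 145–146] -/
theorem comp_eq_one_iff_of_blocks {O : Type*} (𝔞 : Set O) (act : O → (X ⟶ X))
    (hj : ∀ ⦃T : SchemeOver k⦄ (t : T ⟶ X), (∃ t' : T ⟶ G, t' ≫ j = t) ↔ ∀ a ∈ 𝔞, t ≫ act a = 1)
    (hK₁ : ∀ ⦃T : SchemeOver k⦄ (t : T ⟶ X), t ≫ ψ₁ = 1 → ∀ a ∈ 𝔞, t ≫ act a = 1)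
    (hK₂ : ∀ ⦃T : SchemeOver k⦄ (t : T ⟶ X), t ≫ ψ₂ = 1 → ∀ a ∈ 𝔞, t ≫ act a = 1)
    (hκ₁ : ∀ ⦃T : SchemeOver k⦄ (t : T ⟶ G), (∃ s : T ⟶ K₁, s ≫ κ₁ = t) ↔ (t ≫ j) ≫ ψ₁ = 1)
    (hκ₂ : ∀ ⦃T : SchemeOver k⦄ (t : T ⟶ G), (∃ s : T ⟶ K₂, s ≫ κ₂ = t) ↔ (t ≫ j) ≫ ψ₂ = 1)
    (hsum : εW * εV = 𝟙 G) (hVV : εV ≫ εV = εV) (hadj : εW ≫ e.hom = e.hom ≫ cartierDualMap εV)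
    (hlag₁ : ∀ ⦃T : SchemeOver k⦄ (t : T ⟶ G), (∃ s : T ⟶ K₁, s ≫ κ₁ = t) ↔ (t ≫ e.hom) ≫ cartierDualMap κ₁ = 1)
    (hlag₂ : ∀ ⦃T : SchemeOver k⦄ (t : T ⟶ G), (∃ s : T ⟶ K₂, s ≫ κ₂ = t) ↔ (t ≫ e.hom) ≫ cartierDualMap κ₂ = 1)
    (hV₁ : ∀ ⦃T : SchemeOver k⦄ (t : T ⟶ G), (∃ s : T ⟶ K₁, s ≫ κ₁ = t) → ∃ s : T ⟶ K₁, s ≫ κ₁ = t ≫ εV)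
    (hV₂ : ∀ ⦃T : SchemeOver k⦄ (t : T ⟶ G), (∃ s : T ⟶ K₂, s ≫ κ₂ = t) → ∃ s : T ⟶ K₂, s ≫ κ₂ = t ≫ εV)
    (hV : ∀ ⦃T : SchemeOver k⦄ (t : T ⟶ G), t ≫ εV = t → ((∃ s : T ⟶ K₁, s ≫ κ₁ = t) ↔ ∃ s : T ⟶ K₂, s ≫ κ₂ = t))
    ⦃T : SchemeOver k⦄ (t : T ⟶ X) : t ≫ ψ₁ = 1 ↔ t ≫ ψ₂ = 1 := by
  have hG : ∀ t' : T ⟶ G, (t' ≫ j) ≫ ψ₁ = 1 ↔ (t' ≫ j) ≫ ψ₂ = 1 := fun t' => by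
    rw [← hκ₁ t', ← hκ₂ t']
    exact exists_comp_eq_iff_of_lagrangian_of_blocks G e εW εV K₁ κ₁ K₂ κ₂ hsum hVV hadj hlag₁ hlag₂ hV₁ hV₂ hV t'
  constructor
  · intro h
    obtain ⟨t', rfl⟩ := (hj t).mpr (hK₁ t h)
    exact (hG t').mp h
  · intro h
    obtain ⟨t', rfl⟩ := (hj t).mpr (hK₂ t h)
    exact (hG t').mpr h

omit [GrpObj X] [GrpObj G] [IsCommMonObj G] [IsAffine G.left] [IsMonHom εV] [GrpObj K₁] [IsCommMonObj K₁] [IsAffine K₁.left] [Module.Free k (Alg K₁)]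
  [Module.Finite k (Alg K₁)] [IsMonHom κ₁] [Mono κ₁] in
/-- **(C6′-stab) `exists_comp_eq_comp_of_equivariant`** — the kernel of an equivariant homomorphism is stable under a block idempotent that is an
action element. [cite: MumfordFogartyKirwan1994, Ch. 7 §2 Definition 7.2 (p. 129)] -/
theorem exists_comp_eq_comp_of_equivariant {O : Type*} (act : O → (X ⟶ X)) (act' : O → (Y₁ ⟶ Y₁)) [∀ a, IsMonHom (act' a)] (c : O)
    (hεj : εV ≫ j = j ≫ act c) (hψ : act c ≫ ψ₁ = ψ₁ ≫ act' c)
    (hκ₁ : ∀ ⦃T : SchemeOver k⦄ (t : T ⟶ G), (∃ s : T ⟶ K₁, s ≫ κ₁ = t) ↔ (t ≫ j) ≫ ψ₁ = 1)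
    ⦃T : SchemeOver k⦄ (t : T ⟶ G) (ht : ∃ s : T ⟶ K₁, s ≫ κ₁ = t) : ∃ s : T ⟶ K₁, s ≫ κ₁ = t ≫ εV := by
  rw [hκ₁] at ht ⊢
  simp only [Category.assoc]
  rw [reassoc_of% hεj, hψ, ← Category.assoc, ← Category.assoc, ht, MonObj.one_comp]

omit [GrpObj X] [GrpObj G] [IsCommMonObj G] [IsAffine G.left] [IsMonHom εV] [GrpObj K₁] [IsCommMonObj K₁] [IsAffine K₁.left] [Module.Free k (Alg K₁)]
  [Module.Finite k (Alg K₁)] [IsMonHom κ₁] [Mono κ₁] [GrpObj K₂] [IsCommMonObj K₂] [IsAffine K₂.left] [Module.Free k (Alg K₂)] [Module.Finite k (Alg K₂)]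
  [IsMonHom κ₂] [Mono κ₂] in
/-- **(C6′-V) `exists_comp_iff_of_dock`** — two kernels read by one clause on a dock through which the `ε_V`-fixed points factor have the same
`V`-part. [cite: Tate1997FiniteFlatGroupSchemes, (3.7)] [cite: MumfordAV1970, §23 Thm. 2 (p. 231)] -/
theorem exists_comp_iff_of_dock {G₀ : SchemeOver k} (ι₀ : G₀ ⟶ X) (Pd : ∀ ⦃T : SchemeOver k⦄, (T ⟶ G₀) → Prop)
    (hfix : ∀ ⦃T : SchemeOver k⦄ (t : T ⟶ G), t ≫ εV = t → ∃ s : T ⟶ G₀, s ≫ ι₀ = t ≫ j)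
    (hdock₁ : ∀ ⦃T : SchemeOver k⦄ (s : T ⟶ G₀), s ≫ ι₀ ≫ ψ₁ = 1 ↔ Pd s)
    (hdock₂ : ∀ ⦃T : SchemeOver k⦄ (s : T ⟶ G₀), s ≫ ι₀ ≫ ψ₂ = 1 ↔ Pd s)
    (hκ₁ : ∀ ⦃T : SchemeOver k⦄ (t : T ⟶ G), (∃ s : T ⟶ K₁, s ≫ κ₁ = t) ↔ (t ≫ j) ≫ ψ₁ = 1)
    (hκ₂ : ∀ ⦃T : SchemeOver k⦄ (t : T ⟶ G), (∃ s : T ⟶ K₂, s ≫ κ₂ = t) ↔ (t ≫ j) ≫ ψ₂ = 1)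
    ⦃T : SchemeOver k⦄ (t : T ⟶ G) (ht : t ≫ εV = t) :
    (∃ s : T ⟶ K₁, s ≫ κ₁ = t) ↔ ∃ s : T ⟶ K₂, s ≫ κ₂ = t := by
  obtain ⟨s, hs⟩ := hfix t ht
  rw [hκ₁, hκ₂, ← hs, Category.assoc, Category.assoc, hdock₁, hdock₂]


end KernelEqOfBlocks

/-! ### §2 `ε_V`-stability from a bare intertwiner on the target -/

section CommGlue



variable {k : Type u} [Field k] {X Y₁ : SchemeOver k} [GrpObj X] [GrpObj Y₁]
  (G : SchemeOver k) (j : G ⟶ X) (εV : G ⟶ G) (K₁ : SchemeOver k) (κ₁ : K₁ ⟶ G) (ψ₁ : X ⟶ Y₁)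

/-- **An endomorphism `b` intertwined with a homomorphism along a homomorphism preserves the unit**: `ι(c) ≫ ψ = ψ ≫ b` with `ι(c)`, `ψ` homomorphisms ⟹ `η ≫ b = η`
(`η_Y = η_X ≫ ψ`, `η_X ≫ ι(c) = η_X`). [cite: MumfordFogartyKirwan1994, Ch. 7 §2 Definition 7.2 (p. 129)] -/
theorem one_comp_eq_one_of_comm (actc : X ⟶ X) [IsMonHom actc] [IsMonHom ψ₁] (b : Y₁ ⟶ Y₁) (hψ : actc ≫ ψ₁ = ψ₁ ≫ b) :
    η[Y₁] ≫ b = η[Y₁] := by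
  have h1 : η[X] ≫ ψ₁ = η[Y₁] := IsMonHom.one_hom ψ₁
  have h2 : η[X] ≫ actc = η[X] := IsMonHom.one_hom actc
  calc η[Y₁] ≫ b = (η[X] ≫ ψ₁) ≫ b := by rw [h1]
    _ = η[X] ≫ (actc ≫ ψ₁) := by rw [Category.assoc, hψ]
    _ = η[Y₁] := by rw [← Category.assoc, h2, h1]

omit [GrpObj X] in
/-- **(C6′-stab′) `exists_comp_eq_comp_of_comm` — AS (C6′-stab) `exists_comp_eq_comp_of_equivariant`, WITHOUT ASSUMING THE TARGET INTERTWINER IS A HOMOMORPHISM**: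
if `ε_V ≫ j = j ≫ ι(c)` and `ι(c) ≫ ψ = ψ ≫ b` for SOME endomorphism `b` of `Y` with `η ≫ b = η` (`one_comp_eq_one_of_comm`), then `K = Ker (j ≫ ψ)` (points clause
`hκ`) is `ε_V`-stable. [cite: MumfordFogartyKirwan1994, Ch. 7 §2 Definition 7.2 (p. 129)] -/
theorem exists_comp_eq_comp_of_comm (actc : X ⟶ X) (b : Y₁ ⟶ Y₁) (hb : η[Y₁] ≫ b = η[Y₁])
    (hεj : εV ≫ j = j ≫ actc) (hψ : actc ≫ ψ₁ = ψ₁ ≫ b)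
    (hκ₁ : ∀ ⦃T : SchemeOver k⦄ (t : T ⟶ G), (∃ s : T ⟶ K₁, s ≫ κ₁ = t) ↔ (t ≫ j) ≫ ψ₁ = 1)
    ⦃T : SchemeOver k⦄ (t : T ⟶ G) (ht : ∃ s : T ⟶ K₁, s ≫ κ₁ = t) : ∃ s : T ⟶ K₁, s ≫ κ₁ = t ≫ εV := by
  rw [hκ₁] at ht ⊢
  have h : ((t ≫ εV) ≫ j) ≫ ψ₁ = ((t ≫ j) ≫ ψ₁) ≫ b := by
    simp only [Category.assoc]
    rw [reassoc_of% hεj, hψ]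
  rw [h, ht]
  change (toUnit T ≫ η[Y₁]) ≫ b = toUnit T ≫ η[Y₁]
  rw [Category.assoc, hb]


end CommGlue

end AffineGroupScheme

end Literature.AlgebraicGeometry.GroupSchemes

end
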